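import Summits.AtomisticToContinuum.HydrodynamicLimit.Theorems.CollisionIsometryCLTCollisionalTransferLocalityLawsAssembly
import Summits.AtomisticToContinuum.HydrodynamicLimit.Theorems.CollisionIsometryCLTCollisionalTransferLocalityMomentumEngineOfEvenStress
import HarnessLib

/-!
# The crux `CollisionalTransferLocality` as an ASSEMBLY over named statements, after the dock on `EvenStressEnskog`
(line `hemisphere-affine-slaving`, stmt-AtomisticToContinuum-9518; registered helpers `collisionalTransferLocality_of_items_c10`,
`collisionalTransferLocalityPreShock_of_items_c10`)

ASSEMBLY CERTIFICATES (seat c10; the planner-facing form of skeleton v19.4, cf. `Cruxes/CollisionalTransferLocality/RoutePatchC10.md`).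
Seat c9's …LawsAssembly proved the crux from `FastMomentRelaxation` (9522), `CollisionMomentBound` (15144), the two engine statements
`CollisionalStressLaw` [Kσ], `CollisionalEnergyFluxLaw` [Kq] (…DefsD) and the `∀ t` dilute ceiling [S'] (resp. `KineticRangeControl` 9201 for the
pre-shock form). Seat c10 docked [Kσ] on the sibling crux `JParityClosure.EvenStressEnskog` (13079) modulo the ONE-BODY two-scale statement [TS]
(`collisionalStressLaw_of_evenStress_of_twoScale`, …MomentumEngineOfEvenStress). Composing:
* `collisionalTransferLocality_of_items_c10 : FastMomentRelaxation → CollisionMomentBound → EvenStressEnskog → [TS] → CollisionalEnergyFluxLaw → [S'] →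
  CollisionalTransferLocality` (the FILED `∀ t` crux BY NAME);
* `collisionalTransferLocalityPreShock_of_items_c10 : FastMomentRelaxation → CollisionMomentBound → EvenStressEnskog → [TS] → CollisionalEnergyFluxLaw →
  KineticRangeControl → CollisionalTransferLocalityPreShock` (seat c1's pre-shock restatement C′, …DefsB) — NO `∀ t` input.
[TS] is written out verbatim (= `TwoScaleValueRegularity` of …DefsF, = registered stub `stub_twoScaleValueA`); [S'] verbatim (= `stub_ceilingAllTimes`).
So 9518 ⟸ {9522, 15144, 13079} BY NAME + {[TS], [Kq], [S']}; pre-shock ⟸ {9522, 15144, 13079, 9201} + {[TS], [Kq]}.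
-/

namespace Summit.AtomisticToContinuum.HydrodynamicLimit.Theorems.HemisphereAffineSlaving

open scoped BigOperators Topology Classical ENNReal InnerProductSpace
open Filter Set Function MeasureTheory

noncomputable section

open Literature.MathematicalPhysics.KineticTheory (T3 V3)

/-- **Registered helper `collisionalTransferLocality_of_items_c10`: the filed `∀ t` crux from 9522, 15144, 13079 by name and [TS], [Kq], [S'].** -/
theorem collisionalTransferLocality_of_items_c10 : Summit.AtomisticToContinuum.HydrodynamicLimit.Theses.StiffCollisionalRelaxation.FastMomentRelaxation → Summit.AtomisticToContinuum.HydrodynamicLimit.Theses.InformationPercolationEngine.CollisionMomentBound → Summit.AtomisticToContinuum.HydrodynamicLimit.Theses.JParityClosure.EvenStressEnskog → (∀ (a₀ θ₀ : T3 → ℝ) (u₀ : T3 → V3), NiceProfiles a₀ θ₀ u₀ → ∃ σ₀ : ℝ, 0 < σ₀ ∧ ∃ η₁ : ℝ, 0 < η₁ ∧ ∀ σ : ℝ, 0 < σ → σ < σ₀ → ∀ (Φ : Flows σ) (t : ℝ), 0 < t → ∀ (γ C : ℝ) (φ : ℕ → T3 → ℝ), 0 < γ → γ ≤ 1 / 15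 → AdmissibleKernel γ C φ → DiluteAt σ a₀ θ₀ u₀ Φ t φ η₁ → ∀ (A : ℝ → T3 → Fin 3 → Fin 3 → ℝ), SmoothMatrixOn (Icc 0 t) A → ∀ τ ∈ Icc 0 t, ∀ η δ : ℝ, 0 < η → 0 < δ → ∃ r₀ : ℝ, 0 < r₀ ∧ ∀ r : ℝ, 0 < r → r < r₀ → ∃ N₀ : ℕ, ∀ N : ℕ, N₀ ≤ N → Literature.MathematicalPhysics.KineticTheory.localGibbsLaw σ a₀ u₀ θ₀ N (Φ N) {z | η < |(RhsA σ Φ (fun (_ : ℕ) (y : T3) => Literature.MathematicalPhysics.KineticTheory.coneKernel r y 0) A N z τ + KfunA σ Φ (fun (_ : ℕ) (y : T3) => Literature.MathematicalPhysics.KineticTheory.coneKernel r y 0) A N z τ) - (RhsA σ Φ φ A N z τ + KfunA σ Φ φ A N z τ)|} ≤ ENNReal.ofReal δ) → CollisionalEnergyFluxLaw → (∀ η₁ : ℝ, 0 < η₁ → ∀ (a₀ θ₀ : T3 → ℝ) (u₀ : T3 → V3), NiceProfiles a₀ θ₀ u₀ → ∃ σ₀ : ℝ, 0 < σ₀ ∧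 ∀ σ : ℝ, 0 < σ → σ < σ₀ → ∀ (Φ : Flows σ) (t : ℝ), 0 < t → ∀ (γ C : ℝ) (φ : ℕ → T3 → ℝ), 0 < γ → γ ≤ 1 / 15 → AdmissibleKernel γ C φ → DiluteAt σ a₀ θ₀ u₀ Φ t φ η₁) → Summit.AtomisticToContinuum.HydrodynamicLimit.Theses.StiffCollisionalRelaxation.CollisionalTransferLocality :=
  fun hF hM h79 hTS hKq hS =>
    collisionalTransferLocality_of_laws hF hM (collisionalStressLaw_of_evenStress_of_twoScale h79 hTS) hKq hS

/-- **Registered helper `collisionalTransferLocalityPreShock_of_items_c10`: the pre-shock form from 9522, 15144, 13079, 9201 by name and [TS], [Kq].** -/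
theorem collisionalTransferLocalityPreShock_of_items_c10 : Summit.AtomisticToContinuum.HydrodynamicLimit.Theses.StiffCollisionalRelaxation.FastMomentRelaxation → Summit.AtomisticToContinuum.HydrodynamicLimit.Theses.InformationPercolationEngine.CollisionMomentBound → Summit.AtomisticToContinuum.HydrodynamicLimit.Theses.JParityClosure.EvenStressEnskog → (∀ (a₀ θ₀ : T3 → ℝ) (u₀ : T3 → V3), NiceProfiles a₀ θ₀ u₀ → ∃ σ₀ : ℝ, 0 < σ₀ ∧ ∃ η₁ : ℝ, 0 < η₁ ∧ ∀ σ : ℝ, 0 < σ → σ < σ₀ → ∀ (Φ : Flows σ) (t : ℝ), 0 < t → ∀ (γ C : ℝ) (φ : ℕ → T3 → ℝ), 0 < γ → γ ≤ 1 / 15 → AdmissibleKernel γ C φ → DiluteAt σ a₀ θ₀ u₀ Φ t φ η₁ → ∀ (A : ℝ → T3 → Fin 3 → Fin 3 → ℝ), SmoothMatrixOn (Icc 0 t) A → ∀ τ ∈ Icc 0 t, ∀ η δ : ℝ, 0 < η → 0 < δ → ∃ r₀ : ℝ, 0 < r₀ ∧ ∀ r : ℝ, 0 < r → r < r₀ →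 ∃ N₀ : ℕ, ∀ N : ℕ, N₀ ≤ N → Literature.MathematicalPhysics.KineticTheory.localGibbsLaw σ a₀ u₀ θ₀ N (Φ N) {z | η < |(RhsA σ Φ (fun (_ : ℕ) (y : T3) => Literature.MathematicalPhysics.KineticTheory.coneKernel r y 0) A N z τ + KfunA σ Φ (fun (_ : ℕ) (y : T3) => Literature.MathematicalPhysics.KineticTheory.coneKernel r y 0) A N z τ) - (RhsA σ Φ φ A N z τ + KfunA σ Φ φ A N z τ)|} ≤ ENNReal.ofReal δ) → CollisionalEnergyFluxLaw → Summit.AtomisticToContinuum.HydrodynamicLimit.Theses.GermanoSplitLES.KineticRangeControl → CollisionalTransferLocalityPreShock :=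
  fun hF hM h79 hTS hKq hK =>
    collisionalTransferLocalityPreShock_of_laws hF hM (collisionalStressLaw_of_evenStress_of_twoScale h79 hTS) hKq hK

end

end Summit.AtomisticToContinuum.HydrodynamicLimit.Theorems.HemisphereAffineSlaving
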